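import Summits.KontsevichZagierPeriods.KontsevichZagierPeriods.Theorems.HurwitzMicroSectorsNormalFormPrincipleDlogMoves
import Summits.KontsevichZagierPeriods.KontsevichZagierPeriods.Theorems.HurwitzMicroSectorsNormalFormPrincipleSplitMoves

/-!
# `NormalFormPrinciple` (stmt-KontsevichZagierPeriods-3869), line `SketchIdeator1` — registered
# sub-goal `nf_pole_one` (siege k9, Mathlib-API route): a simple rational pole off `[0,1]` is in
# the normal form "rational point + prime carriers"

Pure proof file (`--supports` the crux). For the representation `T = [(0,1), c/(x − ρ)]`
(`c, ρ ∈ ℚ`, `ρ ∉ [0,1]`) and any families `R a b c = [(a,b), c/y]` (`0 < a`), `Z r = [pt, r]`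
we prove, in `FormalRep ⧸ relations`,

  `[T] = [Z r] + ∑_{p ∈ S} [R 1 p (C p)]`

with `r = 0`, `S` a finite set of primes and `C : ℕ → ℚ` supported on `S`. The moves:

1. one affine move (rule 2; `x ↦ x − ρ` if `ρ < 0`, `x ↦ ρ − x` if `ρ > 1`, both from
   `affine_sub_mem_relations`) onto a dlog representation `[(a,b), ±c/y]`, `0 < a < b` rational;
2. one dilation (rule 2, `dlog_scale_mem_relations`) onto integer ends `[(A,B), c'/y]` and one
   splitting (rule 1a, `split_mem_relations`): `[(A,B)] ≡ [(1,B)] − [(1,A)]`;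
3. complete multiplicativity of the carriers `Λ(N,c) = [(1,N), c/y]` modulo relations,
   `Λ(p·a, c) ≡ Λ(p, c) + Λ(a, c)` (split at `p`, rescale `[(p, pa)]` to `[(1,a)]`), whence
   `Λ(N, c) ≡ ∑_p v_p(N) • Λ(p, c)` by `induction_on_primes` and `Nat.factorization_mul`
   (the Mathlib API for unique factorisation: `Nat.factorization`, `Finsupp.sum_add_index'`);
4. additivity in `c` (rule 1b, `dlog_merge_mem_relations`) turns `n • Λ(p, c)` into `Λ(p, n c)`,
   and `[Z 0] ≡ 0` (`pt_zero_mem_relations`).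

Sources: M. Kontsevich, D. Zagier, *Periods* (2001), §1.1 (`log 2 = ∫₁² dx/x`), §1.2 rules
(1), (2). No definitions are introduced; the move lemmas are those of
`…NormalFormPrincipleDlogMoves.lean` and `…NormalFormPrincipleSplitMoves.lean`.
-/

noncomputable section

open MeasureTheory Set Finset
open Literature.NumberTheory.Transcendental Literature.NumberTheory.Transcendental.KZ

namespace Summit.KontsevichZagierPeriods.Theorems.HurwitzMicroSectorsNormalFormPrincipleNfPoleOneK9

open Summit.KontsevichZagierPeriods.HurwitzMicroSectors.NormalFormPrinciple.PiBox.Dlog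

/-! ## Classes modulo relations -/

/-- Two formal combinations differing by a relation have the same class in
`FormalRep ⧸ relations`. [folklore] -/
theorem mk'_eq_of_sub_mem {x y : FormalRep} (h : x - y ∈ relations) :
    QuotientAddGroup.mk' relations x = QuotientAddGroup.mk' relations y := by
  rw [QuotientAddGroup.mk'_apply, QuotientAddGroup.mk'_apply, QuotientAddGroup.eq_iff_sub_mem]
  exact h

/-! ## The carriers `[(a,b), c/y]` modulo relations -/

/-- **Additivity in the numerator** (rule 1b): `[(a,b), (c+c')/y] = [(a,b), c/y] + [(a,b), c'/y]`
in `FormalRep ⧸ relations`. [cite: KontsevichZagier2001, §1.2 rule (1)] -/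
theorem mk'_dlog_add {R : ℚ → ℚ → ℚ → IntegralRep 1}
    (hR : ∀ a b c, 0 < a → (R a b c).domain = {x | x 0 ∈ Set.Ioo (a:ℝ) b} ∧
      (R a b c).integrand = fun x => (c:ℝ) / x 0)
    {a : ℚ} (ha : 0 < a) (b c c' : ℚ) :
    QuotientAddGroup.mk' relations (of (R a b (c + c'))) =
      QuotientAddGroup.mk' relations (of (R a b c)) +
        QuotientAddGroup.mk' relations (of (R a b c')) := by
  have h := dlog_merge_mem_relations (σ := {x | x 0 ∈ Set.Ioo (a:ℝ) b}) (c := c) (c' := c')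
    (R a b (c + c')) (R a b c) (R a b c') (hR a b _ ha).1 (hR a b _ ha).1 (hR a b _ ha).1
    (by rw [(hR a b _ ha).2]; exact fun _ _ => rfl) (by rw [(hR a b _ ha).2]; exact fun _ _ => rfl)
    (by rw [(hR a b _ ha).2]; exact fun _ _ => rfl)
  rw [← map_add]
  exact mk'_eq_of_sub_mem (by rwa [sub_add_eq_sub_sub])

/-- **`ℤ`-linearity in the numerator**: `[(a,b), (n c)/y] = n • [(a,b), c/y]` in
`FormalRep ⧸ relations` for `n ∈ ℤ` (rule 1b iterated). [cite: KontsevichZagier2001, §1.2 rule (1)] -/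
theorem mk'_dlog_zsmul {R : ℚ → ℚ → ℚ → IntegralRep 1}
    (hR : ∀ a b c, 0 < a → (R a b c).domain = {x | x 0 ∈ Set.Ioo (a:ℝ) b} ∧
      (R a b c).integrand = fun x => (c:ℝ) / x 0)
    {a : ℚ} (ha : 0 < a) (b c : ℚ) (n : ℤ) :
    QuotientAddGroup.mk' relations (of (R a b ((n:ℚ) * c))) =
      n • QuotientAddGroup.mk' relations (of (R a b c)) := by
  let φ : ℚ →+ FormalRep ⧸ relations :=
    AddMonoidHom.mk' (fun c => QuotientAddGroup.mk' relations (of (R a b c))) (mk'_dlog_add hR ha b)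
  have h := map_zsmul φ n c
  rwa [zsmul_eq_mul] at h

/-- **Multiplicativity of the carriers** `Λ(N, c) = [(1,N), c/y]`: for `1 ≤ p`, `1 ≤ a`,
`Λ(p·a, c) = Λ(p, c) + Λ(a, c)` in `FormalRep ⧸ relations` — split `[(1, pa)]` at `p`
(rule 1a) and rescale `[(p, pa), c/y]` to `[(1, a), c/y]` by `y ↦ p y` (rule 2).
[cite: KontsevichZagier2001, §1.2 rules (1), (2)] -/
theorem mk'_carrier_mul {R : ℚ → ℚ → ℚ → IntegralRep 1}
    (hR : ∀ a b c, 0 < a → (R a b c).domain = {x | x 0 ∈ Set.Ioo (a:ℝ) b} ∧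
      (R a b c).integrand = fun x => (c:ℝ) / x 0)
    {p a : ℕ} (hp : 1 ≤ p) (ha : 1 ≤ a) (c : ℚ) :
    QuotientAddGroup.mk' relations (of (R 1 ((p * a : ℕ)) c)) =
      QuotientAddGroup.mk' relations (of (R 1 p c)) +
        QuotientAddGroup.mk' relations (of (R 1 a c)) := by
  have hp0 : (0:ℚ) < p := by exact_mod_cast hp
  -- rule 2: `[(1,a), c/y] − [(p, pa), c/y] ∈ relations`
  have hscale : of (R 1 a c) - of (R p ((p * a : ℕ)) c) ∈ relations := by
    refine dlog_scale_mem_relations (a := 1) (b := a) (c := c) (s := p) (R 1 a c)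
      (R p ((p * a : ℕ)) c) (hR 1 a c one_pos).1 ?_ ?_ ?_ one_pos hp0
    · rw [(hR p _ c hp0).1, mul_one, Nat.cast_mul]
    · rw [(hR 1 a c one_pos).2]; exact fun _ _ => rfl
    · rw [(hR p _ c hp0).2]; exact fun _ _ => rfl
  -- rule 1a: `[(1,pa)] − [(1,p)] − [(p,pa)] ∈ relations`
  have hsplit : of (R 1 ((p * a : ℕ)) c) - of (R 1 p c) - of (R p ((p * a : ℕ)) c) ∈
      relations := by
    refine split_mem_relations (a := ((1:ℚ):ℝ)) (b := ((p:ℚ):ℝ)) (b' := (((p * a : ℕ):ℚ):ℝ))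
      _ _ _ (hR 1 _ c one_pos).1 (hR 1 p c one_pos).1 (hR p _ c hp0).1 ?_ ?_ ?_ ?_
    · exact_mod_cast hp
    · exact_mod_cast Nat.le_mul_of_pos_right p ha
    · rw [(hR 1 p c one_pos).2, (hR 1 _ c one_pos).2]; exact fun _ _ => rfl
    · rw [(hR p _ c hp0).2, (hR 1 _ c one_pos).2]; exact fun _ _ => rfl
  have h1 := mk'_eq_of_sub_mem hsplit
  rw [map_sub] at h1
  rw [mk'_eq_of_sub_mem hscale, ← h1]
  abel

/-- **Prime decomposition of a carrier** (`Finsupp` form): for `N ≠ 0`,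
`Λ(N, c) = ∑_p v_p(N) • Λ(p, c)` in `FormalRep ⧸ relations`, by `induction_on_primes` and
`Nat.factorization_mul` — unique factorisation is the only arithmetic input.
[cite: KontsevichZagier2001, §1.1] -/
theorem mk'_carrier_eq_factorization_sum {R : ℚ → ℚ → ℚ → IntegralRep 1}
    (hR : ∀ a b c, 0 < a → (R a b c).domain = {x | x 0 ∈ Set.Ioo (a:ℝ) b} ∧
      (R a b c).integrand = fun x => (c:ℝ) / x 0)
    {N : ℕ} (hN : N ≠ 0) (c : ℚ) :
    QuotientAddGroup.mk' relations (of (R 1 N c)) =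
      N.factorization.sum fun p k => k • QuotientAddGroup.mk' relations (of (R 1 p c)) := by
  induction N using induction_on_primes with
  | zero => exact absurd rfl hN
  | one =>
    rw [Nat.factorization_one, Finsupp.sum_zero_index]
    exact (QuotientAddGroup.eq_zero_iff _).mpr
      (slab_empty_mem_relations (R 1 ((1:ℕ):ℚ) c) (hR 1 _ c one_pos).1 (by norm_num))
  | prime_mul p a hp ih =>
    have ha : a ≠ 0 := by rintro rfl; exact hN (mul_zero p)
    rw [Nat.factorization_mul hp.ne_zero ha,
      Finsupp.sum_add_index'
        (h := fun (p : ℕ) (k : ℕ) => k • QuotientAddGroup.mk' relations (of (R 1 (p:ℚ) c)))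
        (fun _ => zero_nsmul _) (fun _ _ _ => add_nsmul _ _ _),
      hp.factorization,
      Finsupp.sum_single_index
        (h := fun (p : ℕ) (k : ℕ) => k • QuotientAddGroup.mk' relations (of (R 1 (p:ℚ) c)))
        (zero_nsmul _),
      one_nsmul, ← ih ha]
    exact mk'_carrier_mul hR hp.one_lt.le (Nat.one_le_iff_ne_zero.mpr ha) c

/-- **Prime decomposition of a carrier**: for `N ≠ 0`,
`[(1,N), c/y] = ∑_{p ∣ N prime} v_p(N) • [(1,p), c/y]` in `FormalRep ⧸ relations`.
[cite: KontsevichZagier2001, §1.1] -/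
theorem mk'_carrier_eq_sum_primeFactors {R : ℚ → ℚ → ℚ → IntegralRep 1}
    (hR : ∀ a b c, 0 < a → (R a b c).domain = {x | x 0 ∈ Set.Ioo (a:ℝ) b} ∧
      (R a b c).integrand = fun x => (c:ℝ) / x 0)
    {N : ℕ} (hN : N ≠ 0) (c : ℚ) :
    QuotientAddGroup.mk' relations (of (R 1 N c)) =
      ∑ p ∈ N.primeFactors, N.factorization p • QuotientAddGroup.mk' relations (of (R 1 p c)) := by
  rw [mk'_carrier_eq_factorization_sum hR hN c, Finsupp.sum, Nat.support_factorization]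

/-- **Integer ends**: for rationals `0 < a < b`, `[(a,b), c/y] = [(1,B), c/y] − [(1,A), c/y]` in
`FormalRep ⧸ relations` for some naturals `A, B ≠ 0` (`b/a = B/A`; one dilation `y ↦ (A/a) y`,
rule 2, and one splitting at `A`, rule 1a). [cite: KontsevichZagier2001, §1.2 rules (1), (2)] -/
theorem mk'_dlog_eq_carrier_sub {R : ℚ → ℚ → ℚ → IntegralRep 1}
    (hR : ∀ a b c, 0 < a → (R a b c).domain = {x | x 0 ∈ Set.Ioo (a:ℝ) b} ∧
      (R a b c).integrand = fun x => (c:ℝ) / x 0)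
    {a b : ℚ} (ha : 0 < a) (hab : a < b) (c : ℚ) :
    ∃ A B : ℕ, A ≠ 0 ∧ B ≠ 0 ∧
      QuotientAddGroup.mk' relations (of (R a b c)) =
        QuotientAddGroup.mk' relations (of (R 1 B c)) -
          QuotientAddGroup.mk' relations (of (R 1 A c)) := by
  set q : ℚ := b / a with hq
  have hq0 : 0 < q := div_pos (ha.trans hab) ha
  have hnum : 0 < q.num := Rat.num_pos.mpr hq0
  have hBpos : 0 < q.num.toNat := Int.lt_toNat.mpr (by simpa using hnum)
  refine ⟨q.den, q.num.toNat, q.den_ne_zero, hBpos.ne', ?_⟩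
  have hA0 : (0:ℚ) < q.den := by exact_mod_cast q.den_pos
  have hBq : ((q.num.toNat : ℕ) : ℚ) = q.num := by exact_mod_cast Int.toNat_of_nonneg hnum.le
  have hs : 0 < (q.den : ℚ) / a := div_pos hA0 ha
  have hsa : (q.den : ℚ) / a * a = q.den := div_mul_cancel₀ _ ha.ne'
  have hsb : (q.den : ℚ) / a * b = (q.num.toNat : ℕ) := by
    rw [hBq, div_mul_eq_mul_div, mul_div_assoc, ← hq, Rat.den_mul_eq_num]
  have hAB : (q.den : ℚ) < (q.num.toNat : ℕ) := by
    rw [← hsa, ← hsb]; exact mul_lt_mul_of_pos_left hab hs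
  -- rule 2: `[(a,b), c/y] − [(A,B), c/y] ∈ relations`
  have hscale : of (R a b c) - of (R q.den (q.num.toNat : ℕ) c) ∈ relations := by
    refine dlog_scale_mem_relations (a := a) (b := b) (c := c) (s := (q.den : ℚ) / a) (R a b c)
      (R q.den (q.num.toNat : ℕ) c) (hR a b c ha).1 ?_ ?_ ?_ ha hs
    · rw [(hR _ _ c hA0).1, hsa, hsb]
    · rw [(hR a b c ha).2]; exact fun _ _ => rfl
    · rw [(hR _ _ c hA0).2]; exact fun _ _ => rfl
  -- rule 1a: `[(1,B)] − [(1,A)] − [(A,B)] ∈ relations`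
  have hsplit : of (R 1 (q.num.toNat : ℕ) c) - of (R 1 q.den c) -
      of (R q.den (q.num.toNat : ℕ) c) ∈ relations := by
    refine split_mem_relations (a := ((1:ℚ):ℝ)) (b := ((q.den:ℚ):ℝ))
      (b' := (((q.num.toNat : ℕ):ℚ):ℝ)) _ _ _ (hR 1 _ c one_pos).1 (hR 1 _ c one_pos).1
      (hR _ _ c hA0).1 ?_ ?_ ?_ ?_
    · exact_mod_cast q.den_pos
    · exact_mod_cast hAB.le
    · rw [(hR 1 _ c one_pos).2, (hR 1 _ c one_pos).2]; exact fun _ _ => rfl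
    · rw [(hR _ _ c hA0).2, (hR 1 _ c one_pos).2]; exact fun _ _ => rfl
  rw [mk'_eq_of_sub_mem hscale, ← map_sub]
  exact (mk'_eq_of_sub_mem hsplit).symm

/-! ## The affine move onto a dlog representation -/

/-- **A simple rational pole off `[0,1]` is a dlog representation** modulo one affine move
(rule 2): `[(0,1), c/(x−ρ)] = [(−ρ, 1−ρ), c/y]` (`x ↦ x − ρ`) if `ρ < 0`, and
`= [(ρ−1, ρ), (−c)/y]` (`x ↦ ρ − x`) if `ρ > 1`. [cite: KontsevichZagier2001, §1.2 rule (2)] -/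
theorem mk'_pole_eq_dlog {R : ℚ → ℚ → ℚ → IntegralRep 1}
    (hR : ∀ a b c, 0 < a → (R a b c).domain = {x | x 0 ∈ Set.Ioo (a:ℝ) b} ∧
      (R a b c).integrand = fun x => (c:ℝ) / x 0)
    {c ρ : ℚ} (hρ : (ρ:ℝ) ∉ Set.Icc (0:ℝ) 1) (T : IntegralRep 1)
    (hTd : T.domain = {x | x 0 ∈ Set.Ioo (0:ℝ) 1})
    (hTi : EqOn T.integrand (fun x => (c:ℝ) / (x 0 - ρ)) T.domain) :
    ∃ a b c' : ℚ, 0 < a ∧ a < b ∧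
      QuotientAddGroup.mk' relations (of T) = QuotientAddGroup.mk' relations (of (R a b c')) := by
  rw [Set.mem_Icc, not_and_or, not_le, not_le] at hρ
  rcases hρ with hρ | hρ
  · -- `ρ < 0`: the shift `x ↦ x − ρ`
    have hρ' : ρ < 0 := by exact_mod_cast hρ
    have ha : (0:ℚ) < -ρ := by linarith
    refine ⟨-ρ, 1 - ρ, c, ha, by linarith, mk'_eq_of_sub_mem ?_⟩
    refine affine_sub_mem_relations (s := 1) (t := -ρ) one_ne_zero T (R (-ρ) (1 - ρ) c)
      (fun y => (c:ℝ) / y) ?_ ?_ ?_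
    · have e1 : ((1:ℚ):ℝ) * 0 + ((-ρ:ℚ):ℝ) = ((-ρ:ℚ):ℝ) := by ring
      have e2 : ((1:ℚ):ℝ) * 1 + ((-ρ:ℚ):ℝ) = ((1 - ρ : ℚ):ℝ) := by push_cast; ring
      rw [hTd, image_affine_slab_of_pos (by norm_num : (0:ℝ) < ((1:ℚ):ℝ)), e1, e2,
        (hR _ _ _ ha).1]
    · rw [(hR _ _ _ ha).2]; exact fun _ _ => rfl
    · intro x hx
      rw [hTi hx]
      simp only [Rat.cast_one, Rat.cast_neg, one_mul, abs_one, mul_one, sub_eq_add_neg]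
  · -- `1 < ρ`: the reflection `x ↦ ρ − x`
    have hρ' : 1 < ρ := by exact_mod_cast hρ
    have ha : (0:ℚ) < ρ - 1 := by linarith
    refine ⟨ρ - 1, ρ, -c, ha, by linarith, mk'_eq_of_sub_mem ?_⟩
    refine affine_sub_mem_relations (s := -1) (t := ρ) (by norm_num) T (R (ρ - 1) ρ (-c))
      (fun y => ((-c:ℚ):ℝ) / y) ?_ ?_ ?_
    · have e1 : ((-1:ℚ):ℝ) * 1 + ((ρ:ℚ):ℝ) = ((ρ - 1 : ℚ):ℝ) := by push_cast; ring
      have e2 : ((-1:ℚ):ℝ) * 0 + ((ρ:ℚ):ℝ) = ((ρ:ℚ):ℝ) := by ring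
      rw [hTd, image_affine_slab_of_neg (by norm_num : ((-1:ℚ):ℝ) < 0), e1, e2,
        (hR _ _ _ ha).1]
    · rw [(hR _ _ _ ha).2]; exact fun _ _ => rfl
    · intro x hx
      rw [hTi hx]
      simp only [Rat.cast_one, Rat.cast_neg, neg_one_mul, abs_neg, abs_one, mul_one,
        neg_add_eq_sub]
      rw [← neg_sub (x 0) (ρ:ℝ), neg_div_neg_eq]

/-! ## The registered sub-goal -/

/-- **Registered sub-goal `nf_pole_one` of crux stmt-KontsevichZagierPeriods-3869, line
`SketchIdeator1` (split-denominator layer of `stub_boxRigidity`).** A simple rational pole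
`T = [(0,1), c/(x − ρ)]` with `ρ ∈ ℚ ∖ [0,1]` is, modulo `KZ.relations`, in the normal form
"rational point + prime carriers": `[T] = [Z r] + ∑_{p ∈ S} [R 1 p (C p)]` with `r = 0`, `S` a
finite set of primes and `C` supported on `S` — concretely `C p = (v_p(B) − v_p(A)) · c'` where
`[T] ≡ [(A,B), c'/y]` after one affine move and one dilation (value `c' log (B/A)`).
Moves: rule 2 (affine, dilation), rule 1a (splitting), rule 1b (merging numerators); arithmetic
input: unique factorisation (`Nat.factorization`). [cite: KontsevichZagier2001, §1.1, §1.2] -/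
theorem nf_pole_one {R : ℚ → ℚ → ℚ → IntegralRep 1} {Z : ℚ → IntegralRep 0} (hR : ∀ a b c, 0 < a → (R a b c).domain = {x | x 0 ∈ Set.Ioo (a:ℝ) b} ∧ (R a b c).integrand = fun x => (c:ℝ) / x 0) (hZ : ∀ r, (Z r).domain = univ ∧ (Z r).integrand = fun _ => (r:ℝ)) {c ρ : ℚ} (hρ : (ρ:ℝ) ∉ Set.Icc (0:ℝ) 1) (T : IntegralRep 1) (hTd : T.domain = {x | x 0 ∈ Set.Ioo (0:ℝ) 1}) (hTi : EqOn T.integrand (fun x => (c:ℝ) / (x 0 - ρ)) T.domain) : ∃ (r : ℚ) (S : Finset ℕ) (C : ℕ → ℚ), (∀ p ∈ S, p.Prime) ∧ (∀ p, p ∉ S → C p = 0) ∧ QuotientAddGroup.mk' relations (of T) = QuotientAddGroup.mk' relations (of (Z r)) + ∑ p ∈ S, QuotientAddGroup.mk' relations (of (R 1 p (C p))) := by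
  classical
  -- (1) one affine move onto a dlog representation `[(a,b), c'/y]`, `0 < a < b`
  obtain ⟨a, b, c', ha, hab, hT⟩ := mk'_pole_eq_dlog hR hρ T hTd hTi
  -- (2) integer ends: `[(a,b), c'/y] = Λ(B, c') − Λ(A, c')`
  obtain ⟨A, B, hA, hB, hL⟩ := mk'_dlog_eq_carrier_sub hR ha hab c'
  -- (3) the normal form: `r = 0`, `S` = primes of `A·B`, `C p = (v_p(B) − v_p(A)) c'`
  have hZ0 : QuotientAddGroup.mk' relations (of (Z 0)) = 0 :=
    (QuotientAddGroup.eq_zero_iff _).mpr (pt_zero_mem_relations (Z 0) (by rw [(hZ 0).2]; simp))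
  have hvB : ∀ p, p ∉ B.primeFactors → B.factorization p = 0 := fun p hp =>
    Finsupp.notMem_support_iff.mp (by rwa [Nat.support_factorization])
  have hvA : ∀ p, p ∉ A.primeFactors → A.factorization p = 0 := fun p hp =>
    Finsupp.notMem_support_iff.mp (by rwa [Nat.support_factorization])
  refine ⟨0, B.primeFactors ∪ A.primeFactors,
    fun p => (((B.factorization p : ℕ) : ℤ) - ((A.factorization p : ℕ) : ℤ) : ℤ) * c', ?_, ?_, ?_⟩
  · intro p hp
    rcases Finset.mem_union.mp hp with h | h <;> exact Nat.prime_of_mem_primeFactors h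
  · intro p hp
    rw [Finset.mem_union, not_or] at hp
    simp [hvB p hp.1, hvA p hp.2]
  · rw [hT, hL, hZ0, zero_add]
    simp_rw [mk'_dlog_zsmul hR one_pos, sub_zsmul, Finset.sum_add_distrib,
      Finset.sum_neg_distrib, natCast_zsmul, ← sub_eq_add_neg,
      mk'_carrier_eq_sum_primeFactors hR hB c', mk'_carrier_eq_sum_primeFactors hR hA c']
    congr 1
    · exact Finset.sum_subset Finset.subset_union_left fun p _ hp => by
        rw [hvB p hp, zero_nsmul]
    · exact Finset.sum_subset Finset.subset_union_right fun p _ hp => by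
        rw [hvA p hp, zero_nsmul]

end Summit.KontsevichZagierPeriods.Theorems.HurwitzMicroSectorsNormalFormPrincipleNfPoleOneK9
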